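import Mathlib
import Summits.QuantumFields.BalabanUV.Beta.AnalyticWalkSum216RowConstrainedCoercive

/-!
# [Balaban1985BackgroundPropagators] (3.186) p. 432 — THE TWO NONSINGULARITY INPUTS OF THE CONSTRAINED LAYER FROM
# COERCIVITY: b09's `hKa : IsUnit (K + a·Q̃ᵀQ̃).det` and `hPr : IsUnit (Q̃(K + a·Q̃ᵀQ̃)⁻¹Q̃ᵀ).det` of
# `AnalyticWalkSum216RowConstrained(Dict).termSum_constrainedΩ_flucCov(_embed)` (interface item (I5)) are CONSEQUENCES of
# «`K` Hermitian and `Re`-coercive, `a ≥ 0`, `Q̃` real» and of E-I3's quasi-reconstruction — so (I5)'s nonsingularity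
# clauses leave the O.2 interface list (cell topic `Summits/QuantumFields/BalabanUV/Beta`; row-D4 NODE A.4, (I3)∕(I5))

HONEST FRAMING (cell rule).  Discharging `BetaPertH` makes Bałaban's UV stability UNCONDITIONAL — a real constructive-QFT
result; NOT the continuum limit, NOT the Clay problem.  This module discharges NOTHING of `BetaPertH`.  [folklore] linear
algebra, kernel-checked: a `Re`-coercive matrix is nonsingular (d4-p3's `AccretiveCombesThomas.isUnit_of_reCoercive` BY
NAME), the a-regularised form `K + a·Q̃ᵀQ̃` inherits `K`'s coercivity (`a ≥ 0`, `Q̃` real: `Re z*(Q̃ᵀQ̃)z = ‖Q̃z‖² ≥ 0`), and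
the coarse operator `Q̃(K + a·Q̃ᵀQ̃)⁻¹Q̃ᵀ` is coercive by `AnalyticWalkSum216RowConstrainedCoercive.reCoercive_coarse_of_
quasiReconstruction` once a quasi-reconstruction for `Q̃` exists (NOTE-I3's E-I3).  Hence the census's interface item (I5)
«b09's two nonsingularity inputs» is NOT an independent O.2 datum: it follows from (I1)'s positivity of `G₂⁻¹` and E-I3
(`nonsingular_inputs_of_quasiReconstruction`).  Nothing of Bałaban's operators is instantiated; NO class change on any GAPS
row; readiness width 0 unchanged; NOT summit progress.  Unit `b2b-balaban-beta-an4-g39` (owner lineage of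
`BINDER-OWNERS.md` row D4); `GAPS.md` C-an4-108.

CITATION HEADER (lean-in-tree rule).  [13] = T. Bałaban, *Propagators for lattice gauge theories in a background field*,
Commun. Math. Phys. **99**, 389–434 (1985) [Balaban1985BackgroundPropagators], (3.186) p. 432 (quoted in the siblings'
headers).  LOCATOR only; nothing printed is asserted.

WHAT IS CERTIFIED HERE (kernel, sorry-free; [folklore]).
§1 `re_form_transpose_mul` (`Re z*(Q̃ᵀQ̃)z = ‖Q̃z‖²` for real `Q̃`), `reCoercive_add_regulariser` (`K` `Re`-coercive `γ`, `a ≥ 0`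
   ⟹ `K + a·Q̃ᵀQ̃` `Re`-coercive `γ`), `isHermitian_add_regulariser`, `re_psd_add_regulariser`.
§2 **`isUnit_det_regularised`** (b09's `hKa` from coercivity of `K`), **`isUnit_det_coarse_of_quasiReconstruction`** (b09's
   `hPr` from a quasi-reconstruction), **`nonsingular_inputs_of_quasiReconstruction`** (both at once).
§3 Non-vacuity on the two-site block (`K = 1`, `a = 1`, `Q̃ = (1 1)`, `r = q`).
NOT CLAIMED.  E-I3 for any lattice; anything about Bałaban's operators.  NOT summit progress.
PRIOR ART IN THE TREE (searched 2026-08-20): d4-p3 `isUnit_of_reCoercive`∕`isUnit_of_conjCoercive` (USED BY NAME); b09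
`CompositionSingular.isUnit_kkt_det_of_reg` (bordered-system nonsingularity from the same two inputs — downstream, not a
supplier); the gen-39 siblings.
-/

namespace Summit.QuantumFields.BalabanUV.Beta.AnalyticWalkSum216RowConstrainedUnits

open scoped BigOperators Matrix ComplexConjugate
open Finset Matrix
open Summit.QuantumFields.BalabanUV.Beta.AnalyticWalkSum216RowConstrainedCoercive (mulVec_star_of_real
  reCoercive_coarse_of_quasiReconstruction Qt₂ A₂ Qt₂_real A₂_isHermitian det_A₂)
open Summit.QuantumFields.BalabanUV.Beta.AccretiveCombesThomas (isUnit_of_reCoercive)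
open Summit.QuantumFields.BalabanUV.Beta.UnitLatticeResolventWalk (Qm superpose)
open Literature.MathematicalPhysics.QuantumFieldTheory.Balaban1983to89.B5Prop11Lower (nsq nsq_nonneg
  star_dotProduct_self)

noncomputable section

variable {μ X : Type*} [Fintype μ] [Fintype X] [DecidableEq μ] [DecidableEq X]

/-! ## §1 The a-regularised form inherits coercivity -/

omit [DecidableEq μ] [DecidableEq X] in
/-- `z*(Q̃ᵀQ̃)z = ‖Q̃z‖²` (cast to `ℂ`) for a REAL `Q̃`. [folklore] -/
theorem form_transpose_mul (Qt : Matrix μ X ℂ) (hreal : ∀ a x, (starRingEnd ℂ) (Qt a x) = Qt a x) (z : X → ℂ) :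
    star z ⬝ᵥ ((Qtᵀ * Qt) *ᵥ z) = ((nsq (Qt *ᵥ z) : ℝ) : ℂ) := by
  rw [← Matrix.mulVec_mulVec, Matrix.dotProduct_mulVec, Matrix.vecMul_transpose, mulVec_star_of_real Qt hreal,
    star_dotProduct_self]

omit [DecidableEq μ] [DecidableEq X] in
/-- **`K + a·Q̃ᵀQ̃` is `Re`-coercive with `K`'s constant** (`a ≥ 0`, `Q̃` real). [folklore] -/
theorem reCoercive_add_regulariser (K : Matrix X X ℂ) {γ : ℝ} (hK : ∀ z : X → ℂ, γ * nsq z ≤ (star z ⬝ᵥ (K *ᵥ z)).re)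
    (Qt : Matrix μ X ℂ) (hreal : ∀ a x, (starRingEnd ℂ) (Qt a x) = Qt a x) {a : ℝ} (ha : 0 ≤ a) (z : X → ℂ) :
    γ * nsq z ≤ (star z ⬝ᵥ ((K + ((a : ℝ) : ℂ) • (Qtᵀ * Qt)) *ᵥ z)).re := by
  rw [Matrix.add_mulVec, dotProduct_add, Complex.add_re, Matrix.smul_mulVec, dotProduct_smul, smul_eq_mul,
    form_transpose_mul Qt hreal, ← Complex.ofReal_mul, Complex.ofReal_re]
  have := hK z
  have := mul_nonneg ha (nsq_nonneg (Qt *ᵥ z))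
  linarith

omit [Fintype X] [DecidableEq μ] [DecidableEq X] in
/-- `K + a·Q̃ᵀQ̃` is Hermitian when `K` is and `Q̃` is real, `a` real. [folklore] -/
theorem isHermitian_add_regulariser (K : Matrix X X ℂ) (hK : K.IsHermitian) (Qt : Matrix μ X ℂ)
    (hreal : ∀ a x, (starRingEnd ℂ) (Qt a x) = Qt a x) (a : ℝ) : (K + ((a : ℝ) : ℂ) • (Qtᵀ * Qt)).IsHermitian := by
  have hT : Qtᴴ = Qtᵀ := by
    ext x b
    rw [Matrix.conjTranspose_apply, Matrix.transpose_apply, Complex.star_def, hreal]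
  have hT' : (Qtᵀ)ᴴ = Qt := by rw [← hT, Matrix.conjTranspose_conjTranspose]
  have hG : (Qtᵀ * Qt).IsHermitian := by
    rw [Matrix.IsHermitian, Matrix.conjTranspose_mul, hT, hT']
  have hsm : (((a : ℝ) : ℂ) • (Qtᵀ * Qt)).IsHermitian := by
    rw [Matrix.IsHermitian, Matrix.conjTranspose_smul, hG.eq, Complex.star_def, Complex.conj_ofReal]
  exact hK.add hsm

omit [DecidableEq μ] [DecidableEq X] in
/-- … and `Re`-positive semidefinite when `K` is and `a ≥ 0`. [folklore] -/
theorem re_psd_add_regulariser (K : Matrix X X ℂ) (hK : ∀ z : X → ℂ, 0 ≤ (star z ⬝ᵥ (K *ᵥ z)).re) (Qt : Matrix μ X ℂ)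
    (hreal : ∀ a x, (starRingEnd ℂ) (Qt a x) = Qt a x) {a : ℝ} (ha : 0 ≤ a) (z : X → ℂ) :
    0 ≤ (star z ⬝ᵥ ((K + ((a : ℝ) : ℂ) • (Qtᵀ * Qt)) *ᵥ z)).re := by
  have h := reCoercive_add_regulariser K (γ := 0) (fun z => by rw [zero_mul]; exact hK z) Qt hreal ha z
  rwa [zero_mul] at h

/-! ## §2 b09's two nonsingularity inputs -/

omit [DecidableEq μ] in
/-- **b09's `hKa` FROM COERCIVITY**: `K` `Re`-coercive (`γ > 0`), `a ≥ 0`, `Q̃` real ⟹ `IsUnit (K + a·Q̃ᵀQ̃).det`.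
[cite: Balaban1985BackgroundPropagators, (3.186) p.432] -/
theorem isUnit_det_regularised (K : Matrix X X ℂ) {γ : ℝ} (hγ : 0 < γ)
    (hK : ∀ z : X → ℂ, γ * nsq z ≤ (star z ⬝ᵥ (K *ᵥ z)).re) (Qt : Matrix μ X ℂ)
    (hreal : ∀ a x, (starRingEnd ℂ) (Qt a x) = Qt a x) {a : ℝ} (ha : 0 ≤ a) :
    IsUnit (K + ((a : ℝ) : ℂ) • (Qtᵀ * Qt)).det :=
  (Matrix.isUnit_iff_isUnit_det _).1 (isUnit_of_reCoercive hγ (reCoercive_add_regulariser K hK Qt hreal ha))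

/-- **b09's `hPr` FROM A QUASI-RECONSTRUCTION**: with `A := K + a·Q̃ᵀQ̃` (`K` Hermitian and `Re`-coercive, `a ≥ 0`, `Q̃`
real) and a quasi-reconstruction `r` for `Q̃` relative to `A` (mass coercivity `c`, energy `E`):
`IsUnit (Q̃·A⁻¹·Q̃ᵀ).det`. [cite: Balaban1985BackgroundPropagators, (3.186) p.432] -/
theorem isUnit_det_coarse_of_quasiReconstruction (K : Matrix X X ℂ) (hKH : K.IsHermitian) {γ : ℝ} (hγ : 0 < γ)
    (hK : ∀ z : X → ℂ, γ * nsq z ≤ (star z ⬝ᵥ (K *ᵥ z)).re) (Qt : Matrix μ X ℂ)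
    (hreal : ∀ a x, (starRingEnd ℂ) (Qt a x) = Qt a x) {a : ℝ} (ha : 0 ≤ a) (r : μ → X → ℂ) {c E : ℝ} (hc : 0 < c)
    (hE : 0 < E) (hmass : ∀ B : μ → ℂ, c * nsq B ≤ (star (superpose r B) ⬝ᵥ superpose (fun b x => Qt b x) B).re)
    (hen : ∀ B : μ → ℂ, (star (superpose r B) ⬝ᵥ ((K + ((a : ℝ) : ℂ) • (Qtᵀ * Qt)) *ᵥ superpose r B)).re ≤ E * nsq B) :
    IsUnit (Qt * (K + ((a : ℝ) : ℂ) • (Qtᵀ * Qt))⁻¹ * Qtᵀ).det := by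
  have hK0 : ∀ z : X → ℂ, 0 ≤ (star z ⬝ᵥ (K *ᵥ z)).re := fun z =>
    (mul_nonneg hγ.le (nsq_nonneg z)).trans (hK z)
  have hco := reCoercive_coarse_of_quasiReconstruction (K + ((a : ℝ) : ℂ) • (Qtᵀ * Qt))
    (isHermitian_add_regulariser K hKH Qt hreal a)
    (isUnit_of_reCoercive hγ (reCoercive_add_regulariser K hK Qt hreal ha)) (re_psd_add_regulariser K hK0 Qt hreal ha)
    Qt hreal r hc hE hmass hen
  exact (Matrix.isUnit_iff_isUnit_det _).1 (isUnit_of_reCoercive (div_pos (pow_pos hc 2) hE) hco)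

/-- **INTERFACE ITEM (I5)'S NONSINGULARITY CLAUSES ARE CONSEQUENCES**: under «`K` Hermitian `Re`-coercive, `a ≥ 0`, `Q̃`
real» and E-I3's quasi-reconstruction, BOTH inputs `hKa`, `hPr` of `termSum_constrainedΩ_flucCov(_embed)` hold. [folklore] -/
theorem nonsingular_inputs_of_quasiReconstruction (K : Matrix X X ℂ) (hKH : K.IsHermitian) {γ : ℝ} (hγ : 0 < γ)
    (hK : ∀ z : X → ℂ, γ * nsq z ≤ (star z ⬝ᵥ (K *ᵥ z)).re) (Qt : Matrix μ X ℂ)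
    (hreal : ∀ a x, (starRingEnd ℂ) (Qt a x) = Qt a x) {a : ℝ} (ha : 0 ≤ a) (r : μ → X → ℂ) {c E : ℝ} (hc : 0 < c)
    (hE : 0 < E) (hmass : ∀ B : μ → ℂ, c * nsq B ≤ (star (superpose r B) ⬝ᵥ superpose (fun b x => Qt b x) B).re)
    (hen : ∀ B : μ → ℂ, (star (superpose r B) ⬝ᵥ ((K + ((a : ℝ) : ℂ) • (Qtᵀ * Qt)) *ᵥ superpose r B)).re ≤ E * nsq B) :
    IsUnit (K + ((a : ℝ) : ℂ) • (Qtᵀ * Qt)).det ∧ IsUnit (Qt * (K + ((a : ℝ) : ℂ) • (Qtᵀ * Qt))⁻¹ * Qtᵀ).det :=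
  ⟨isUnit_det_regularised K hγ hK Qt hreal ha,
    isUnit_det_coarse_of_quasiReconstruction K hKH hγ hK Qt hreal ha r hc hE hmass hen⟩

/-! ## §3 Non-vacuity: the two-site block -/

/-- On the two-site block (`K = 1`, `a = 1`, `Q̃ = (1 1)`, so `K + a·Q̃ᵀQ̃ = A₂ = [[2,1],[1,2]]`; `r = q`: `c = 2`, `E = 6`)
both nonsingularity inputs follow — consistently with `det A₂ = 3`, `Q̃A₂⁻¹Q̃ᵀ = ⅔`. [folklore] -/
example : IsUnit ((1 : Matrix (Fin 2) (Fin 2) ℂ) + ((1 : ℝ) : ℂ) • (Qt₂ᵀ * Qt₂)).det ∧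
    IsUnit (Qt₂ * ((1 : Matrix (Fin 2) (Fin 2) ℂ) + ((1 : ℝ) : ℂ) • (Qt₂ᵀ * Qt₂))⁻¹ * Qt₂ᵀ).det := by
  have hA : (1 : Matrix (Fin 2) (Fin 2) ℂ) + ((1 : ℝ) : ℂ) • (Qt₂ᵀ * Qt₂) = A₂ := by
    rw [A₂, Complex.ofReal_one, one_smul]
  have hsup : ∀ B : Fin 1 → ℂ, superpose (fun a x => Qt₂ a x) B = fun _ => B 0 := fun B => by
    ext x
    simp [superpose, Qm, Qt₂, Matrix.mulVec, dotProduct, Matrix.conjTranspose_apply]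
  have hnsq1 : ∀ B : Fin 1 → ℂ, nsq B = ‖B 0‖ ^ 2 := fun B => by simp [nsq]
  have hnsq2 : ∀ c : ℂ, nsq (fun _ : Fin 2 => c) = 2 * ‖c‖ ^ 2 := fun c => by simp [nsq]
  have hQv : ∀ c : ℂ, Qt₂ *ᵥ (fun _ : Fin 2 => c) = fun _ => 2 * c := fun c => by
    ext a
    simp [Matrix.mulVec, dotProduct, Qt₂]
  refine nonsingular_inputs_of_quasiReconstruction 1 Matrix.isHermitian_one one_pos (fun z => ?_) Qt₂ Qt₂_real
    zero_le_one (fun a x => Qt₂ a x) two_pos (by norm_num : (0 : ℝ) < 6) (fun B => ?_) (fun B => ?_)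
  · rw [Matrix.one_mulVec, star_dotProduct_self, Complex.ofReal_re, one_mul]
  · rw [hsup, hnsq1, star_dotProduct_self, Complex.ofReal_re, hnsq2]
  · rw [hA, hsup, hnsq1, show A₂ = 1 + Qt₂ᵀ * Qt₂ from rfl,
      AnalyticWalkSum216RowConstrainedCoercive.form_one_add_gram Qt₂ Qt₂_real, Complex.ofReal_re, hQv, hnsq2, hnsq1]
    simp only [norm_mul, Complex.norm_two]
    nlinarith [norm_nonneg (B 0)]

end

end Summit.QuantumFields.BalabanUV.Beta.AnalyticWalkSum216RowConstrainedUnits
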